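import Literature.Computability.QuantumComplexity.GluedTreesThm9EmbDefs
import Literature.Computability.QuantumComplexity.GluedTreesThm9Master
import Mathlib.Data.ZMod.Basic
import HarnessLib

/-!
# Glued trees, Theorem 9 (classical lower bound) — the random embedding: basic calculus

This module concatenates 4 parts of the proof of `ChildsEtAl2003_thm9`, each with its own
module docstring below: part `EmbBasic`, part `EmbDeep`, part `EmbKinds`, part `EmbDet`.
-/
/-!
# Glued trees, Theorem 9 (classical lower bound) — VIII: basic facts for Lemma 8

Theorem-only support file for `ChildsEtAl2003_thm9`, on the vocabulary of `GluedTreesThm9EmbDefs`: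

* slots: `slotVal_natCast`, `slotVal_slotOf`, `slotOf_slotVal`, and the identification of the
  two cross neighbours of the leaf in slot `x` with the leaves in slots `x + 1`, `x - 1`
  (`cross₁_eq_slotVal`, `cross₂_eq_slotVal`) — "by the construction of the random cycle";
* ancestors and blocks: `depth_anc`, `anc_eq_iff`, `blk_parentV`, `blk_childV`, the number of
  leaves of a block (`card_leaves_blk_le`);
* the two children created by expansion `j` of a valid list, in terms of `stepOpts`
  (`pos_child_eq`), and **the coin forced by an UP move** (`coin_of_isUp_odd`,
  `coin_of_isUp_even`: an up-move of node `2j+1` needs `c j = false`, of node `2j+2` needs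
  `c j = true` — the parent vertex is always the FIRST onward option), which is all that part (i)
  of Lemma 8 uses about the coins.

## References

* [ChildsEtAl2003] A. M. Childs et al., Exponential algorithmic speedup by a quantum walk,
  STOC 2003, §2, §4 (Game 5, Lemma 8).
-/

open Literature.Computability.Complexity

namespace Literature.Computability.QuantumComplexity

namespace GluedTrees

open Finset

variable {n : ℕ}

/-! ### Slots -/

/-- Two small naturals give the same slot iff they are equal. [folklore] -/
theorem slot_natCast_inj {m m' : ℕ} (hm : m < 2 ^ (n + 1)) (hm' : m' < 2 ^ (n + 1)) :
    ((m : Slot n) = (m' : Slot n)) ↔ m = m' := by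
  constructor
  · intro h
    have := congrArg ZMod.val h
    rwa [ZMod.val_natCast_of_lt hm, ZMod.val_natCast_of_lt hm'] at this
  · rintro rfl; rfl

/-- A slot is the cast of its value. [folklore] -/
theorem slot_eq_natCast_val (s : Slot n) : s = ((s.val : ℕ) : Slot n) := (ZMod.natCast_zmod_val s).symm

/-- **The leaf in a slot given by a small natural number**: even `2k ↦ e k`, odd `2k+1 ↦ f k`.
[cite: ChildsEtAl2003, §2] -/
theorem slotVal_natCast (σ : CycleDatum n) {m : ℕ} (hm : m < 2 ^ (n + 1)) :
    slotVal σ (m : Slot n) = if m % 2 = 0 then leafL n (σ.1 ⟨m / 2, by rw [Nat.pow_succ'] at hm; omega⟩)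
      else leafR n (σ.2 ⟨m / 2, by rw [Nat.pow_succ'] at hm; omega⟩) := by
  unfold slotVal slotPos
  simp only [ZMod.val_natCast_of_lt hm]

/-- The leaf `e k` sits in slot `2k`. [cite: ChildsEtAl2003, §2] -/
theorem slotVal_two_mul (σ : CycleDatum n) (k : Fin (2 ^ n)) :
    slotVal σ ((2 * (k : ℕ) : ℕ) : Slot n) = leafL n (σ.1 k) := by
  have hk : 2 * (k : ℕ) < 2 ^ (n + 1) := by rw [Nat.pow_succ']; omega
  rw [slotVal_natCast σ hk, if_pos (by omega)]
  congr 2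
  apply Fin.ext
  simp

/-- The leaf `f k` sits in slot `2k+1`. [cite: ChildsEtAl2003, §2] -/
theorem slotVal_two_mul_add_one (σ : CycleDatum n) (k : Fin (2 ^ n)) :
    slotVal σ ((2 * (k : ℕ) + 1 : ℕ) : Slot n) = leafR n (σ.2 k) := by
  have hk : 2 * (k : ℕ) + 1 < 2 ^ (n + 1) := by rw [Nat.pow_succ']; omega
  rw [slotVal_natCast σ hk, if_neg (by omega)]
  congr 2
  apply Fin.ext
  simp only
  omega

/-- The slot of a left leaf. [cite: ChildsEtAl2003, §2] -/
theorem slotOf_leafL (σ : CycleDatum n) (i : Fin (2 ^ n)) :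
    slotOf σ (leafL n i) = ((2 * (σ.1.symm i : ℕ) : ℕ) : Slot n) := by
  unfold slotOf
  rw [dif_pos (depth_leafL i)]
  simp [leafIdx, idx, leafL]

/-- The slot of a right leaf. [cite: ChildsEtAl2003, §2] -/
theorem slotOf_leafR (σ : CycleDatum n) (i : Fin (2 ^ n)) :
    slotOf σ (leafR n i) = ((2 * (σ.2.symm i : ℕ) + 1 : ℕ) : Slot n) := by
  unfold slotOf
  rw [dif_pos (depth_leafR i)]
  simp [leafIdx, idx, leafR]

/-- Slots hold leaves. [cite: ChildsEtAl2003, §2] -/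
theorem depth_slotVal (σ : CycleDatum n) (s : Slot n) : depth (slotVal σ s) = n := by
  unfold slotVal; split_ifs <;> rfl

/-- The side of the leaf in a slot is the parity of the slot. [cite: ChildsEtAl2003, §2] -/
theorem slotVal_fst (σ : CycleDatum n) (s : Slot n) : (slotVal σ s).1 = decide (s.val % 2 = 1) := by
  unfold slotVal
  split_ifs with h
  · simp [h]
  · simp; omega

/-- `slotVal ∘ slotOf = id` on leaves. [cite: ChildsEtAl2003, §2] -/
theorem slotVal_slotOf (σ : CycleDatum n) {v : Vertex n} (hv : depth v = n) : slotVal σ (slotOf σ v) = v := by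
  obtain ⟨i, rfl | rfl⟩ := exists_eq_leaf hv
  · rw [slotOf_leafL, slotVal_two_mul]; simp
  · rw [slotOf_leafR, slotVal_two_mul_add_one]; simp

/-- `slotOf ∘ slotVal = id`. [cite: ChildsEtAl2003, §2] -/
theorem slotOf_slotVal (σ : CycleDatum n) (s : Slot n) : slotOf σ (slotVal σ s) = s := by
  obtain ⟨m, hs, rfl⟩ : ∃ m : ℕ, m < 2 ^ (n + 1) ∧ s = (m : Slot n) := ⟨s.val, s.val_lt, slot_eq_natCast_val s⟩
  rw [slotVal_natCast σ hs]
  split_ifs with h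
  · rw [slotOf_leafL, Equiv.symm_apply_apply]
    congr 1
    simp only
    omega
  · rw [slotOf_leafR, Equiv.symm_apply_apply]
    congr 1
    simp only
    omega

/-- `slotVal σ` is injective. [cite: ChildsEtAl2003, §2] -/
theorem slotVal_injective (σ : CycleDatum n) : Function.Injective (slotVal σ) := by
  intro s s' h
  rw [← slotOf_slotVal σ s, h, slotOf_slotVal]

/-- `slotOf σ` is injective on leaves. [cite: ChildsEtAl2003, §2] -/
theorem slotOf_inj (σ : CycleDatum n) {v w : Vertex n} (hv : depth v = n) (hw : depth w = n)
    (h : slotOf σ v = slotOf σ w) : v = w := by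
  rw [← slotVal_slotOf σ hv, h, slotVal_slotOf σ hw]

/-- The slot after `2k` is `2k + 1`. [folklore] -/
theorem slot_two_mul_add_one (k : Fin (2 ^ n)) :
    ((2 * (k : ℕ) : ℕ) : Slot n) + 1 = ((2 * (k : ℕ) + 1 : ℕ) : Slot n) := by push_cast; ring

/-- The slot after `2k + 1` is `2(k+1)` (cyclically). [folklore] -/
theorem slot_two_mul_add_one_add_one (k : Fin (2 ^ n)) :
    ((2 * (k : ℕ) + 1 : ℕ) : Slot n) + 1 = ((2 * (finRotate (2 ^ n) k : ℕ) : ℕ) : Slot n) := by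
  haveI : NeZero (2 ^ n) := ⟨by positivity⟩
  rw [finRotate_apply, Fin.val_add, Fin.val_one', Nat.add_mod_mod]
  have hk := k.isLt
  rcases Nat.lt_or_ge ((k : ℕ) + 1) (2 ^ n) with hlt | hge
  · rw [Nat.mod_eq_of_lt hlt]; push_cast; ring
  · have heq : (k : ℕ) + 1 = 2 ^ n := by omega
    rw [heq, Nat.mod_self, mul_zero]
    have h3 : 2 * (k : ℕ) + 1 + 1 = 2 ^ (n + 1) := by rw [Nat.pow_succ']; omega
    rw [← Nat.cast_add_one, h3, ZMod.natCast_self, Nat.cast_zero]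

/-- The slot before `2k + 1` is `2k`. [folklore] -/
theorem slot_two_mul_add_one_sub_one (k : Fin (2 ^ n)) :
    ((2 * (k : ℕ) + 1 : ℕ) : Slot n) - 1 = ((2 * (k : ℕ) : ℕ) : Slot n) := by push_cast; ring

/-- The slot before `2k` is `2(k-1) + 1` (cyclically). [folklore] -/
theorem slot_two_mul_sub_one (hn : 1 ≤ n) (k : Fin (2 ^ n)) :
    ((2 * (k : ℕ) : ℕ) : Slot n) - 1 = ((2 * ((finRotate (2 ^ n)).symm k : ℕ) + 1 : ℕ) : Slot n) := by
  haveI : NeZero (2 ^ n) := ⟨by positivity⟩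
  rw [finRotate_symm_apply, Fin.val_sub, Fin.val_one']
  have hk := k.isLt
  have h1 : 1 % 2 ^ n = 1 := Nat.mod_eq_of_lt (Nat.one_lt_two_pow (by omega))
  rw [h1]
  rcases Nat.eq_zero_or_pos (k : ℕ) with h0 | hpos
  · rw [h0, add_zero, Nat.mod_eq_of_lt (by omega), mul_zero, Nat.cast_zero, zero_sub]
    have : ((2 * (2 ^ n - 1) + 1 : ℕ) : Slot n) + 1 = 0 := by
      have h2 : 2 * (2 ^ n - 1) + 1 + 1 = 2 ^ (n + 1) := by rw [Nat.pow_succ']; omega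
      rw [← Nat.cast_add_one, h2, ZMod.natCast_self]
    exact neg_eq_of_add_eq_zero_left this
  · rw [show 2 ^ n - 1 + (k : ℕ) = (k - 1) + 2 ^ n by omega, Nat.add_mod_right, Nat.mod_eq_of_lt (by omega)]
    have : (2 * (k : ℕ) : ℕ) = (2 * ((k : ℕ) - 1) + 1) + 1 := by omega
    rw [this]; push_cast; ring

/-- **The first cross neighbour of a left leaf sits in the next slot, the second in the previous
one**: `e k — f k`, `f (k-1) — e k`. [cite: ChildsEtAl2003, §2 and §4 (Lemma 8 (ii))] -/
theorem cross_eq_slotVal_left (hn : 1 ≤ n) (σ : CycleDatum n) (i : Fin (2 ^ n)) :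
    cross₁ σ (leafL n i) = slotVal σ (slotOf σ (leafL n i) + 1) ∧
      cross₂ σ (leafL n i) = slotVal σ (slotOf σ (leafL n i) - 1) := by
  rw [cross₁_leafL, cross₂_leafL, slotOf_leafL, slot_two_mul_add_one, slotVal_two_mul_add_one,
    slot_two_mul_sub_one hn, slotVal_two_mul_add_one]
  exact ⟨rfl, rfl⟩

/-- **The first cross neighbour of a right leaf sits in the previous slot, the second in the next
one**: `e k — f k`, `f k — e (k+1)`. [cite: ChildsEtAl2003, §2 and §4 (Lemma 8 (ii))] -/
theorem cross_eq_slotVal_right (σ : CycleDatum n) (i : Fin (2 ^ n)) :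
    cross₁ σ (leafR n i) = slotVal σ (slotOf σ (leafR n i) - 1) ∧
      cross₂ σ (leafR n i) = slotVal σ (slotOf σ (leafR n i) + 1) := by
  rw [cross₁_leafR, cross₂_leafR, slotOf_leafR, slot_two_mul_add_one_sub_one, slotVal_two_mul,
    slot_two_mul_add_one_add_one, slotVal_two_mul]
  exact ⟨rfl, rfl⟩

/-- The two cross neighbours of a leaf are the leaves in the two neighbouring slots.
[cite: ChildsEtAl2003, §2 and §4 (Lemma 8 (ii))] -/
theorem cross_pair_eq_slotVal (hn : 1 ≤ n) (σ : CycleDatum n) {v : Vertex n} (hv : depth v = n) :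
    ({cross₁ σ v, cross₂ σ v} : Finset (Vertex n)) = {slotVal σ (slotOf σ v + 1), slotVal σ (slotOf σ v - 1)} := by
  obtain ⟨i, rfl | rfl⟩ := exists_eq_leaf hv
  · obtain ⟨h1, h2⟩ := cross_eq_slotVal_left hn σ i; rw [h1, h2]
  · obtain ⟨h1, h2⟩ := cross_eq_slotVal_right σ i; rw [h1, h2, Finset.pair_comm]

/-! ### Ancestors and blocks -/

/-- `anc v 0 = v`. [folklore] -/
@[simp] theorem anc_zero (v : Vertex n) : anc v 0 = v := rfl

/-- `anc v (u+1) = parentV (anc v u)`. [folklore] -/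
theorem anc_succ (v : Vertex n) (u : ℕ) : anc v (u + 1) = parentV (anc v u) := rfl

/-- Ancestors are on the same side. [folklore] -/
@[simp] theorem anc_fst (v : Vertex n) (u : ℕ) : (anc v u).1 = v.1 := by
  induction u with
  | zero => rfl
  | succ u ih => rw [anc_succ, parentV_fst, ih]

/-- The depth of an ancestor. [folklore] -/
@[simp] theorem depth_anc (v : Vertex n) (u : ℕ) : depth (anc v u) = depth v - u := by
  induction u with
  | zero => rfl
  | succ u ih => rw [anc_succ, depth_parentV, ih]; omega

/-- The position of an ancestor. [folklore] -/
@[simp] theorem idx_anc (v : Vertex n) (u : ℕ) : idx (anc v u) = idx v / 2 ^ u := by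
  induction u with
  | zero => simp
  | succ u ih => rw [anc_succ, idx_parentV, ih, Nat.div_div_eq_div_mul, ← Nat.pow_succ]

/-- `anc (parentV v) u = anc v (u + 1)`. [folklore] -/
theorem anc_parentV (v : Vertex n) (u : ℕ) : anc (parentV v) u = anc v (u + 1) := by
  induction u with
  | zero => rfl
  | succ u ih => rw [anc_succ, ih]; rfl

/-- `anc (anc v u) u' = anc v (u + u')`. [folklore] -/
theorem anc_anc (v : Vertex n) (u u' : ℕ) : anc (anc v u) u' = anc v (u + u') := by
  induction u' with
  | zero => rfl
  | succ u' ih => rw [anc_succ, ih, ← anc_succ, ← Nat.add_assoc]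

/-- Going down then up: `anc (childV v b) (u + 1) = anc v u`. [folklore] -/
theorem anc_childV {v : Vertex n} (hv : depth v < n) (b : Bool) (u : ℕ) :
    anc (childV v b) (u + 1) = anc v u := by
  rw [← anc_parentV, parentV_childV hv]

/-- **Characterisation of ancestors**: `w = anc v u` (for `u ≤ depth v`) iff `w` is on the side
of `v`, `u` levels up, at the position `idx v / 2^u`. [folklore] -/
theorem eq_anc_iff {v w : Vertex n} {u : ℕ} :
    w = anc v u ↔ w.1 = v.1 ∧ depth w = depth v - u ∧ idx w = idx v / 2 ^ u := by
  rw [Vertex.ext_iff', anc_fst, depth_anc, idx_anc]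

/-- A vertex is an ancestor of itself only trivially: `anc v u = v ↔ u = 0` below the root.
[folklore] -/
theorem anc_eq_self_iff {v : Vertex n} {u : ℕ} (hu : u ≤ depth v) : anc v u = v ↔ u = 0 := by
  constructor
  · intro h
    have := congrArg depth h
    rw [depth_anc] at this
    omega
  · rintro rfl; rfl

/-- Ancestors at different heights are different. [folklore] -/
theorem anc_injective_of_le {v : Vertex n} {u u' : ℕ} (hu : u ≤ depth v) (hu' : u' ≤ depth v)
    (h : anc v u = anc v u') : u = u' := by
  have := congrArg depth h
  rw [depth_anc, depth_anc] at this
  omega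

/-- The depth of a block representative of a deep vertex. [cite: ChildsEtAl2003, §4 (Lemma 8)] -/
theorem depth_blk {h : ℕ} {v : Vertex n} (hv : n + 1 - h ≤ depth v) : depth (blk h v) = n + 1 - h := by
  unfold blk; rw [depth_anc]; omega

/-- A block representative is on the same side. [folklore] -/
@[simp] theorem blk_fst (h : ℕ) (v : Vertex n) : (blk h v).1 = v.1 := anc_fst v _

/-- Moving up inside a block does not change the block. [cite: ChildsEtAl2003, §4 (Lemma 8)] -/
theorem blk_parentV {h : ℕ} {v : Vertex n} (hv : n + 1 - h < depth v) : blk h (parentV v) = blk h v := by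
  unfold blk
  rw [anc_parentV, depth_parentV]
  congr 1
  omega

/-- Moving down from a deep vertex does not change the block. [cite: ChildsEtAl2003, §4 (Lemma 8)] -/
theorem blk_childV {h : ℕ} {v : Vertex n} (hv : n + 1 - h ≤ depth v) (hvn : depth v < n) (b : Bool) :
    blk h (childV v b) = blk h v := by
  unfold blk
  rw [depth_childV hvn, show depth v + 1 - (n + 1 - h) = (depth v - (n + 1 - h)) + 1 by omega,
    anc_childV hvn]

/-- The block of an ancestor inside the block. [cite: ChildsEtAl2003, §4 (Lemma 8)] -/
theorem blk_anc {h : ℕ} {v : Vertex n} {u : ℕ} (hu : n + 1 - h + u ≤ depth v) : blk h (anc v u) = blk h v := by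
  induction u with
  | zero => rfl
  | succ u ih =>
    rw [anc_succ, blk_parentV (by rw [depth_anc]; omega)]
    exact ih (by omega)

/-- Two deep vertices with the same block representative have the same ancestor at depth
`n + 1 - h`. [folklore] -/
theorem blk_eq_anc (h : ℕ) (v : Vertex n) : blk h v = anc v (depth v - (n + 1 - h)) := rfl

/-- **The leaves of a block**: a left leaf `i` lies in the block with representative `B` only if
`i / 2^(h-1) = idx B`; hence at most `2^(h-1)` left leaves per block (`1 ≤ h ≤ n`).
[cite: ChildsEtAl2003, §4 (Lemma 8: subtrees of height `n/2`)] -/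
theorem card_leaves_blk_le {h : ℕ} (hh : h ≤ n + 1) (B : Vertex n) (b : Bool) :
    (Finset.univ.filter fun i : Fin (2 ^ n) ↦ blk h (if b then leafR n i else leafL n i) = B).card ≤ 2 ^ (h - 1) := by
  classical
  -- the leaves of the block have indices in the interval `[idx B * 2^(h-1), idx B * 2^(h-1) + 2^(h-1))`
  have key : ∀ i : Fin (2 ^ n), blk h (if b then leafR n i else leafL n i) = B → (i : ℕ) / 2 ^ (h - 1) = idx B := by
    intro i hi
    have hd : depth (if b then leafR n i else leafL n i) = n := by cases b <;> rfl
    have hidx : idx (if b then leafR n i else leafL n i) = i := by cases b <;> rfl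
    rw [blk_eq_anc, hd] at hi
    have := congrArg idx hi
    rw [idx_anc, hidx, show n - (n + 1 - h) = h - 1 by omega] at this
    exact this
  calc (Finset.univ.filter fun i : Fin (2 ^ n) ↦ blk h (if b then leafR n i else leafL n i) = B).card
      ≤ (Finset.univ.filter fun i : Fin (2 ^ n) ↦ (i : ℕ) / 2 ^ (h - 1) = idx B).card := by
        apply Finset.card_le_card
        intro i hi
        rw [Finset.mem_filter] at hi ⊢
        exact ⟨hi.1, key i hi.2⟩
    _ ≤ 2 ^ (h - 1) := by
        -- inject into `Fin (2^(h-1))` by the remainder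
        have : (Finset.univ.filter fun i : Fin (2 ^ n) ↦ (i : ℕ) / 2 ^ (h - 1) = idx B).card ≤
            (Finset.univ : Finset (Fin (2 ^ (h - 1)))).card := by
          apply Finset.card_le_card_of_injOn (fun i ↦ ⟨(i : ℕ) % 2 ^ (h - 1), Nat.mod_lt _ (Nat.two_pow_pos _)⟩)
          · intro i _; exact Finset.mem_univ _
          · intro i hi i' hi' hii'
            simp only [Finset.coe_filter, Finset.mem_univ, true_and, Set.mem_setOf_eq] at hi hi'
            apply Fin.ext
            have h3 := Fin.mk.inj_iff.mp hii'
            rw [← Nat.div_add_mod (i : ℕ) (2 ^ (h - 1)), ← Nat.div_add_mod (i' : ℕ) (2 ^ (h - 1)), hi, hi', h3]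
        rwa [Finset.card_univ, Fintype.card_fin] at this

/-! ### The children of an expansion -/

/-- Positions of the first `2(j+1)+1` nodes are those of the prefix of length `j+1`.
[cite: ChildsEtAl2003, §4 (Game 5)] -/
theorem pos_eq_pos_take (σ : CycleDatum n) {par : List ℕ} (hval : ∀ i (h : i < par.length), par[i] ≤ 2 * i)
    (c : ℕ → Bool) {j : ℕ} (hj : j ≤ par.length) {m : ℕ} (hm : m ≤ 2 * j) :
    pos σ par c m = pos σ (par.take j) c m := by
  have hlen : (par.take j).length = j := List.length_take_of_le hj
  have hval' : ∀ i (h : i < (par.take j).length), (par.take j)[i] ≤ 2 * i := by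
    intro i hi
    rw [List.getElem_take]
    exact hval i (by rw [hlen] at hi; omega)
  have h1 := posAux_append σ (par.take j) (par.drop j) hval' (c := c) (c' := c) (fun _ _ ↦ rfl) m
  rw [List.take_append_drop, hlen] at h1
  rw [← h1]
  unfold pos
  exact posAux_apply_of_le σ par c hj hm

/-- **The two children of expansion `j`** of a valid list sit at the onward options of the
position of the expanded node `par[j]` (entered from the position of its parent node), the
first created child at option `[c j]`, the second at the other one; a missing option is the
ENTRANCE. [cite: ChildsEtAl2003, §4 (Game 5)] -/
theorem pos_child_eq (σ : CycleDatum n) {par : List ℕ} (hval : ∀ i (h : i < par.length), par[i] ≤ 2 * i)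
    (c : ℕ → Bool) {j : ℕ} (hj : j < par.length) :
    pos σ par c (2 * j + 1) = (stepOpts σ (pos σ par c par[j])
        (if par[j] = 0 then none else some (pos σ par c (parentOf par par[j])))).getD
        (if c j then 1 else 0) (entrance n) ∧
      pos σ par c (2 * j + 2) = (stepOpts σ (pos σ par c par[j])
        (if par[j] = 0 then none else some (pos σ par c (parentOf par par[j])))).getD
        (if c j then 0 else 1) (entrance n) := by
  set p := par[j] with hp
  have hpj : p ≤ 2 * j := hval j hj
  have htake : par.take (j + 1) = par.take j ++ [p] := by
    rw [hp, ← List.take_concat_get' par j hj]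
  have hlen : (par.take j).length = j := List.length_take_of_le hj.le
  have hval' : ∀ i (h : i < (par.take j).length), (par.take j)[i] ≤ 2 * i := by
    intro i hi
    rw [List.getElem_take]
    exact hval i (by rw [hlen] at hi; omega)
  have key := pos_append_singleton σ (par.take j) p (c := c) (c' := c) hval' (fun _ _ ↦ rfl) (by rw [hlen]; exact hpj)
  rw [hlen] at key
  -- the parent lookup in the prefix is the one in `par`
  have hparent : (par.take j).getD ((p - 1) / 2) 0 = parentOf par p := by
    unfold parentOf
    rw [List.getD_eq_getElem?_getD, List.getD_eq_getElem?_getD]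
    rcases Nat.eq_zero_or_pos j with hj0 | hjpos
    · have hp0 : p = 0 := by omega
      have hget : par[j]? = some p := by rw [hp]; exact List.getElem?_eq_getElem hj
      rw [hj0] at hget
      rw [hp0, hj0]
      simp only [List.take_zero, List.getElem?_nil, Option.getD_none, Nat.zero_sub, Nat.zero_div, hget,
        Option.getD_some]
      exact hp0.symm
    · rw [List.getElem?_take_of_lt (by omega)]
  have h1 : pos σ par c (2 * j + 1) = pos σ (par.take (j + 1)) c (2 * j + 1) :=
    pos_eq_pos_take σ hval c hj (by omega)
  have h2 : pos σ par c (2 * j + 2) = pos σ (par.take (j + 1)) c (2 * j + 2) :=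
    pos_eq_pos_take σ hval c hj (by omega)
  have h3 : pos σ (par.take j) c p = pos σ par c p := (pos_eq_pos_take σ hval c hj.le hpj).symm
  have h4 : p ≠ 0 → pos σ (par.take j) c (parentOf par p) = pos σ par c (parentOf par p) := by
    intro hp0
    refine (pos_eq_pos_take σ hval c hj.le ?_).symm
    unfold parentOf
    rw [List.getD_eq_getElem?_getD, List.getElem?_eq_getElem (show (p - 1) / 2 < par.length by omega)]
    simp only [Option.getD_some]
    have := hval ((p - 1) / 2) (by omega)
    omega
  rw [h1, h2, htake, key, hparent]
  simp only [Function.update_self, Function.update_of_ne (show 2 * j + 1 ≠ 2 * j + 2 by omega)]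
  rw [h3]
  by_cases hp0 : p = 0
  · simp [hp0]
  · rw [if_neg hp0, if_neg hp0, h4 hp0]
    exact ⟨rfl, rfl⟩

/-! ### The coin forced by an up-move -/

/-- **The parent vertex is never the second onward option**, and from a non-root vertex there
are always two options (`1 ≤ n`). [cite: ChildsEtAl2003, §4 (Game 5)] -/
theorem stepOpts_parentV_ne_second (σ : CycleDatum n) {v : Vertex n} (hv : 1 ≤ depth v)
    (u : Option (Vertex n)) :
    (stepOpts σ v u).length = 2 ∧ (stepOpts σ v u)[1]? ≠ some (parentV v) := by
  have hpc : ∀ b, childV v b ≠ parentV v := fun b h ↦ by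
    have := congrArg depth h
    rw [depth_parentV] at this
    by_cases hvn : depth v < n
    · rw [depth_childV hvn] at this; omega
    · unfold childV at h; rw [dif_neg hvn] at h
      have := congrArg depth h; rw [depth_parentV] at this; omega
  unfold stepOpts
  by_cases hvn : depth v < n
  · rw [if_pos hvn]
    by_cases hu : u = none ∨ u = some (parentV v)
    · rw [if_pos hu]; exact ⟨rfl, by simpa using hpc true⟩
    · rw [if_neg hu, if_neg (by omega)]
      refine ⟨rfl, ?_⟩
      simp only [List.getElem?_cons_succ, List.getElem?_cons_zero, ne_eq, Option.some.injEq]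
      unfold otherChild; split_ifs <;> exact hpc _
  · rw [if_neg hvn]
    have hv' : depth v = n := le_antisymm (depth_le v) (not_lt.mp hvn)
    have hc1 : cross₁ σ v ≠ parentV v := (parentV_ne_cross₁ hv').symm
    have hc2 : cross₂ σ v ≠ parentV v := (parentV_ne_cross₂ hv').symm
    split_ifs
    · exact ⟨rfl, by simpa using hc2⟩
    · exact ⟨rfl, by simpa using hc2⟩
    · exact ⟨rfl, by simpa using hc1⟩

/-- **The coin of an up-move** (part (i) of Lemma 8: "`π` must choose to move right"): if the
first child `2j+1` of expansion `j` moves UP then `c j = false`, and if the second child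
`2j+2` moves UP then `c j = true`. [cite: ChildsEtAl2003, §4 (Lemma 8 (i))] -/
theorem coin_of_isUp (σ : CycleDatum n) {par : List ℕ} (hval : ∀ i (h : i < par.length), par[i] ≤ 2 * i)
    (c : ℕ → Bool) {j : ℕ} (hj : j < par.length) :
    (IsUp σ par c (2 * j + 1) → c j = false) ∧ (IsUp σ par c (2 * j + 2) → c j = true) := by
  have hpar1 : parentOf par (2 * j + 1) = par[j] := by
    unfold parentOf; rw [List.getD_eq_getElem?_getD, show (2 * j + 1 - 1) / 2 = j by omega,
      List.getElem?_eq_getElem hj]; rfl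
  have hpar2 : parentOf par (2 * j + 2) = par[j] := by
    unfold parentOf; rw [List.getD_eq_getElem?_getD, show (2 * j + 2 - 1) / 2 = j by omega,
      List.getElem?_eq_getElem hj]; rfl
  obtain ⟨h1, h2⟩ := pos_child_eq σ hval c hj
  set os := stepOpts σ (pos σ par c par[j])
    (if par[j] = 0 then none else some (pos σ par c (parentOf par par[j]))) with hos
  constructor
  · rintro ⟨-, hd, hup⟩
    rw [hpar1] at hd hup
    obtain ⟨hlen, hne⟩ := stepOpts_parentV_ne_second σ hd
      (if par[j] = 0 then none else some (pos σ par c (parentOf par par[j])))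
    rw [h1] at hup
    cases hcj : c j
    · rfl
    · exfalso
      rw [hcj, if_pos rfl, List.getD_eq_getElem?_getD] at hup
      apply hne
      rw [← hos] at hlen ⊢
      rw [List.getElem?_eq_getElem (by rw [hlen]; omega)] at hup ⊢
      simp only [Option.getD_some] at hup
      rw [hup]
  · rintro ⟨-, hd, hup⟩
    rw [hpar2] at hd hup
    obtain ⟨hlen, hne⟩ := stepOpts_parentV_ne_second σ hd
      (if par[j] = 0 then none else some (pos σ par c (parentOf par par[j])))
    rw [h2] at hup
    cases hcj : c j
    · exfalso
      rw [hcj] at hup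
      simp only [Bool.false_eq_true, if_false, List.getD_eq_getElem?_getD] at hup
      apply hne
      rw [← hos] at hlen ⊢
      rw [List.getElem?_eq_getElem (by rw [hlen]; omega)] at hup ⊢
      simp only [Option.getD_some] at hup
      rw [hup]
    · rfl

end GluedTrees

end Literature.Computability.QuantumComplexity

/-!
# Glued trees, Theorem 9 (classical lower bound) — IX: part (i) of Lemma 8 (deep climbs are rare)

Theorem-only support file for `ChildsEtAl2003_thm9`. Part (i) of the printed Lemma 8 (p. 13):
"To reach column `n + n/2` from column `n+1`, `π` must choose to move right `n/2 - 1` times in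
a row, which has probability `2^{1-n/2}`. Since there are at most `t` tries on each path of `T`
… the probability is bounded by `t² · 2^{1-n/2}`." Rigorous form proved here, with the sharper
count over nodes instead of (path, try) pairs: for a valid expansion list with `E` expansions and
any `h ≥ 1`,

  `#{(c, σ) : Deep σ par ĉ h} ≤ (2E + 1) · 2^(t - h) · |Σ|`       (`card_deep_le`)

because a node ending `h` consecutive up-moves forces the `h` coins of the (distinct) expansions
that created it and its `h - 1` nearest ancestors (`coin_of_isUp` of `GluedTreesThm9EmbBasic`),
and `h` prescribed coordinates leave `2^(t-h)` coin vectors (`card_le_two_pow_of_forced`).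

## References

* [ChildsEtAl2003] A. M. Childs et al., Exponential algorithmic speedup by a quantum walk,
  STOC 2003, §4, Lemma 8 (i).
-/

open Literature.Computability.Complexity

namespace Literature.Computability.QuantumComplexity

namespace GluedTrees

open Finset
open scoped Classical

variable {n : ℕ}

/-! ### Parents and the up-count -/

/-- In a valid list the parent node of an existing non-root node is an earlier node.
[cite: ChildsEtAl2003, §4 (Game 5)] -/
theorem parentOf_lt {par : List ℕ} (hval : ∀ i (h : i < par.length), par[i] ≤ 2 * i)
    {m : ℕ} (hm1 : 1 ≤ m) (hm : m ≤ 2 * par.length) :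
    parentOf par m = par[(m - 1) / 2]'(by omega) ∧ parentOf par m ≤ m - 1 := by
  have hlt : (m - 1) / 2 < par.length := by omega
  unfold parentOf
  rw [List.getD_eq_getElem?_getD, List.getElem?_eq_getElem hlt]
  simp only [Option.getD_some, true_and]
  have := hval _ hlt
  omega

/-- The root has up-count `0`. [folklore] -/
@[simp] theorem upCount_zero (σ : CycleDatum n) (par : List ℕ) (c : ℕ → Bool) : upCount σ par c 0 = 0 := by
  rw [upCount]

/-- The up-count of a non-root node with an earlier parent. [cite: ChildsEtAl2003, §4 (Lemma 8 (i))] -/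
theorem upCount_of_parentOf_lt (σ : CycleDatum n) (par : List ℕ) (c : ℕ → Bool) {m : ℕ} (hm : m ≠ 0)
    (hp : parentOf par m < m) :
    upCount σ par c m = if IsUp σ par c m then upCount σ par c (parentOf par m) + 1 else 0 := by
  obtain ⟨k, rfl⟩ : ∃ k, m = k + 1 := ⟨m - 1, by omega⟩
  rw [upCount]
  by_cases h : IsUp σ par c (k + 1)
  · rw [dif_pos ⟨hp, h⟩, if_pos h]
  · rw [dif_neg (fun h' ↦ h h'.2), if_neg h]

/-- A positive up-count means an up-move on top of the parent's up-count.
[cite: ChildsEtAl2003, §4 (Lemma 8 (i))] -/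
theorem isUp_of_upCount_pos (σ : CycleDatum n) (par : List ℕ) (c : ℕ → Bool) {m : ℕ}
    (h : 1 ≤ upCount σ par c m) :
    m ≠ 0 ∧ parentOf par m < m ∧ IsUp σ par c m ∧ upCount σ par c m = upCount σ par c (parentOf par m) + 1 := by
  obtain ⟨k, rfl⟩ : ∃ k, m = k + 1 := by
    rcases Nat.eq_zero_or_pos m with rfl | hpos
    · simp at h
    · exact ⟨m - 1, by omega⟩
  rw [upCount] at h ⊢
  split_ifs at h ⊢ with h'
  · exact ⟨Nat.succ_ne_zero k, h'.1, h'.2, rfl⟩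
  · simp at h

/-- **The chain behind a deep node.** If node `m` ends `h` consecutive up-moves then each of its
`h` nearest ancestors-or-self `m, parentOf m, …` is a non-root node reached by an up-move, created
strictly earlier than the previous one. [cite: ChildsEtAl2003, §4 (Lemma 8 (i))] -/
theorem chain_of_upCount (σ : CycleDatum n) (par : List ℕ) (c : ℕ → Bool) {h m : ℕ}
    (hm : h ≤ upCount σ par c m) :
    ∀ i < h, (parentOf par)^[i] m ≠ 0 ∧ IsUp σ par c ((parentOf par)^[i] m) ∧
      (parentOf par)^[i + 1] m < (parentOf par)^[i] m ∧
      h - i ≤ upCount σ par c ((parentOf par)^[i] m) := by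
  intro i
  induction i with
  | zero =>
    intro hi
    simp only [Function.iterate_zero, id_eq, Nat.sub_zero]
    obtain ⟨h1, h2, h3, -⟩ := isUp_of_upCount_pos σ par c (show 1 ≤ upCount σ par c m by omega)
    exact ⟨h1, h3, h2, hm⟩
  | succ i ih =>
    intro hi
    obtain ⟨-, -, -, h4⟩ := ih (by omega)
    have hpos : 1 ≤ upCount σ par c ((parentOf par)^[i] m) := by omega
    obtain ⟨-, -, -, heq⟩ := isUp_of_upCount_pos σ par c hpos
    have hnext : h - (i + 1) ≤ upCount σ par c ((parentOf par)^[i + 1] m) := by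
      rw [Function.iterate_succ_apply']; omega
    obtain ⟨k1, k2, k3, -⟩ := isUp_of_upCount_pos σ par c (show 1 ≤ upCount σ par c ((parentOf par)^[i + 1] m) by omega)
    refine ⟨k1, k3, ?_, hnext⟩
    rw [Function.iterate_succ_apply' (f := parentOf par) (n := i + 1)]
    exact k2

/-! ### Counting coin vectors with forced coordinates -/

/-- Coin vectors agreeing with a fixed assignment on a set `I` of coordinates number at most
`2^(t - |I|)`. [folklore] -/
theorem card_le_two_pow_of_forced (t : ℕ) (I : Finset (Fin t)) (g : Fin t → Bool) (S : Finset (Fin t → Bool))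
    (hS : ∀ c ∈ S, ∀ k ∈ I, c k = g k) : S.card ≤ 2 ^ (t - I.card) := by
  have key : S.card ≤ Fintype.card ({k : Fin t // k ∉ I} → Bool) := by
    rw [← Fintype.card_coe S]
    refine Fintype.card_le_of_injective (fun c ↦ fun k ↦ c.1 k.1) ?_
    intro c c' h
    apply Subtype.ext
    funext k
    by_cases hk : k ∈ I
    · rw [hS c.1 c.2 k hk, hS c'.1 c'.2 k hk]
    · exact congrFun h ⟨k, hk⟩
  rw [Fintype.card_fun, Fintype.card_bool, Fintype.card_subtype_compl, Fintype.card_fin, Fintype.card_coe] at key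
  exact key

/-! ### The bound on deep climbs -/

/-- **A deep node forces `h` coins**: for fixed `σ` and a node `m` of a valid list with
`E ≤ t` expansions, the coin vectors under which `m` ends `h` consecutive up-moves number at
most `2^(t-h)`. [cite: ChildsEtAl2003, §4 (Lemma 8 (i))] -/
theorem card_upCount_ge_le (σ : CycleDatum n) {par : List ℕ} (hval : ∀ i (h : i < par.length), par[i] ≤ 2 * i)
    {t : ℕ} (ht : par.length ≤ t) {m : ℕ} (hm : m ≤ 2 * par.length) (h : ℕ) :
    (Finset.univ.filter fun c : Fin t → Bool ↦
      h ≤ upCount σ par (fun i ↦ if hi : i < t then c ⟨i, hi⟩ else false) m).card ≤ 2 ^ (t - h) := by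
  set S := Finset.univ.filter fun c : Fin t → Bool ↦
      h ≤ upCount σ par (fun i ↦ if hi : i < t then c ⟨i, hi⟩ else false) m with hS
  rcases S.eq_empty_or_nonempty with hemp | ⟨c₀, hc₀⟩
  · rw [hemp]; simp
  -- the chain exists (witnessed by `c₀`): its expansion indices are distinct and `< t`
  set J : ℕ → ℕ := fun i ↦ ((parentOf par)^[i] m - 1) / 2 with hJ
  rw [hS, Finset.mem_filter] at hc₀
  have hchain₀ := chain_of_upCount σ par _ hc₀.2
  -- positions of the chain nodes are bounded by `m`
  have hle : ∀ i ≤ h, (parentOf par)^[i] m ≤ m := by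
    intro i
    induction i with
    | zero => intro; simp
    | succ i ih =>
      intro hi
      have := (hchain₀ i (by omega)).2.2.1
      have := ih (by omega)
      omega
  have hJlt : ∀ i < h, J i < t := by
    intro i hi
    have h1 := (hchain₀ i hi).1
    have h2 := hle i hi.le
    show ((parentOf par)^[i] m - 1) / 2 < t
    omega
  have hJanti : ∀ i, i + 1 < h → J (i + 1) < J i := by
    intro i hi
    obtain ⟨hne, -, -, -⟩ := hchain₀ i (by omega)
    obtain ⟨hne', -, -, -⟩ := hchain₀ (i + 1) hi
    have hkle : (parentOf par)^[i] m ≤ 2 * par.length := (hle i (by omega)).trans hm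
    obtain ⟨hpeq, -⟩ := parentOf_lt hval (Nat.one_le_iff_ne_zero.mpr hne) hkle
    have hval' := hval (((parentOf par)^[i] m - 1) / 2) (by omega)
    have hsucc : (parentOf par)^[i + 1] m = parentOf par ((parentOf par)^[i] m) :=
      Function.iterate_succ_apply' _ _ _
    rw [← hpeq, ← hsucc] at hval'
    show ((parentOf par)^[i + 1] m - 1) / 2 < ((parentOf par)^[i] m - 1) / 2
    clear hpeq hsucc hkle
    generalize (parentOf par)^[i + 1] m = b at hval' hne' ⊢
    generalize (parentOf par)^[i] m = a at hval' hne ⊢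
    have : 1 ≤ b := Nat.one_le_iff_ne_zero.mpr hne'
    omega
  have hJdec : ∀ d i, i + d + 1 < h → J (i + d + 1) < J i := by
    intro d
    induction d with
    | zero => intro i hi; exact hJanti i hi
    | succ d ih =>
      intro i hi
      have h1 := hJanti (i + d + 1) (by omega)
      rw [show i + (d + 1) + 1 = i + d + 1 + 1 by omega]
      exact h1.trans (ih i (by omega))
  have hJsmono : StrictAntiOn J (Set.Iio h) := by
    intro i hi i' hi' hii'
    simp only [Set.mem_Iio] at hi hi'
    obtain ⟨d, rfl⟩ : ∃ d, i' = i + d + 1 := ⟨i' - i - 1, by omega⟩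
    exact hJdec d i hi'
  set I : Finset (Fin t) := (Finset.range h).attach.image fun i ↦ ⟨J i.1, hJlt i.1 (Finset.mem_range.mp i.2)⟩ with hI
  have hIcard : I.card = h := by
    rw [hI, Finset.card_image_of_injOn, Finset.card_attach, Finset.card_range]
    intro i hi i' hi' hii'
    simp only [Finset.coe_attach, Set.mem_univ] at hi hi'
    have := Fin.mk.inj_iff.mp hii'
    apply Subtype.ext
    have h1 := Finset.mem_range.mp i.2
    have h2 := Finset.mem_range.mp i'.2
    by_contra hne
    rcases Nat.lt_or_gt_of_ne hne with hlt | hgt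
    · exact absurd this (ne_of_gt (hJsmono h1 h2 hlt))
    · exact absurd this (ne_of_lt (hJsmono h2 h1 hgt))
  -- the forced values
  let g : Fin t → Bool := fun k ↦ if hk : ∃ i < h, J i = k then decide ((parentOf par)^[hk.choose] m % 2 = 0) else false
  have hforce : ∀ c ∈ S, ∀ k ∈ I, c k = g k := by
    intro c hc k hk
    rw [hS, Finset.mem_filter] at hc
    have hchain := chain_of_upCount σ par _ hc.2
    rw [hI, Finset.mem_image] at hk
    obtain ⟨⟨i, hi⟩, -, rfl⟩ := hk
    have hi' := Finset.mem_range.mp hi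
    have hex : ∃ i' < h, J i' = (⟨J i, hJlt i hi'⟩ : Fin t) := ⟨i, hi', rfl⟩
    simp only [g, dif_pos hex]
    -- `hex.choose = i` by injectivity of `J`
    have hci : hex.choose = i := by
      have h1 := hex.choose_spec
      by_contra hne
      rcases Nat.lt_or_gt_of_ne hne with hlt | hgt
      · exact absurd h1.2 (ne_of_gt (hJsmono h1.1 hi' hlt))
      · exact absurd h1.2 (ne_of_lt (hJsmono hi' h1.1 hgt))
    rw [hci]
    -- the node `k := (parentOf par)^[i] m` is `2 J + 1` or `2 J + 2`, and its up-move forces the coin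
    obtain ⟨hne, hup, -, -⟩ := hchain i hi'
    set k := (parentOf par)^[i] m with hk
    have hJi : J i = (k - 1) / 2 := rfl
    have hJE : J i < par.length := by
      have := hle i hi'.le; rw [← hk] at this; rw [hJi]; omega
    obtain ⟨hodd, heven⟩ := coin_of_isUp σ hval (fun i ↦ if hi : i < t then c ⟨i, hi⟩ else false) hJE
    rcases Nat.even_or_odd k with ⟨r, hr⟩ | ⟨r, hr⟩
    · -- `k = 2J+2`
      have hk2 : k = 2 * J i + 2 := by rw [hJi]; omega
      rw [hk2] at hup
      have := heven hup
      simp only [dif_pos (hJlt i hi')] at this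
      rw [this]
      symm; simp only [decide_eq_true_eq]; omega
    · -- `k = 2J+1`
      have hk1 : k = 2 * J i + 1 := by rw [hJi]; omega
      rw [hk1] at hup
      have := hodd hup
      simp only [dif_pos (hJlt i hi')] at this
      rw [this]
      symm; simp only [decide_eq_false_iff_not]; omega
  have := card_le_two_pow_of_forced t I g S hforce
  rwa [hIcard] at this

/-- **Part (i) of Lemma 8**: for a valid expansion list with `E ≤ t` expansions,
`#{(c, σ) : some node ends h consecutive up-moves} ≤ (2E+1) · 2^(t-h) · |Σ|`.
[cite: ChildsEtAl2003, §4 (Lemma 8 (i))] -/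
theorem card_deep_le {par : List ℕ} (hval : ∀ i (h : i < par.length), par[i] ≤ 2 * i)
    {t : ℕ} (ht : par.length ≤ t) (h : ℕ) :
    (Finset.univ.filter fun cσ : (Fin t → Bool) × CycleDatum n ↦
      Deep cσ.2 par (fun i ↦ if hi : i < t then cσ.1 ⟨i, hi⟩ else false) h).card ≤
      (2 * par.length + 1) * 2 ^ (t - h) * Fintype.card (CycleDatum n) := by
  calc (Finset.univ.filter fun cσ : (Fin t → Bool) × CycleDatum n ↦
        Deep cσ.2 par (fun i ↦ if hi : i < t then cσ.1 ⟨i, hi⟩ else false) h).card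
      ≤ ∑ m ∈ Finset.range (2 * par.length + 1), (Finset.univ.filter fun cσ : (Fin t → Bool) × CycleDatum n ↦
          h ≤ upCount cσ.2 par (fun i ↦ if hi : i < t then cσ.1 ⟨i, hi⟩ else false) m).card := by
        refine (Finset.card_le_card ?_).trans Finset.card_biUnion_le
        intro cσ hc
        rw [Finset.mem_filter] at hc
        obtain ⟨m, hm, hmc⟩ := hc.2
        rw [Finset.mem_biUnion]
        exact ⟨m, Finset.mem_range.mpr (by omega), Finset.mem_filter.mpr ⟨Finset.mem_univ _, hmc⟩⟩
    _ ≤ ∑ _m ∈ Finset.range (2 * par.length + 1), 2 ^ (t - h) * Fintype.card (CycleDatum n) := by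
        apply Finset.sum_le_sum
        intro m hm
        rw [Finset.mem_range] at hm
        rw [card_filter_coins_eq_sum]
        calc ∑ σ : CycleDatum n, (Finset.univ.filter fun c : Fin t → Bool ↦
              h ≤ upCount σ par (fun i ↦ if hi : i < t then c ⟨i, hi⟩ else false) m).card
            ≤ ∑ _σ : CycleDatum n, 2 ^ (t - h) :=
              Finset.sum_le_sum fun σ _ ↦ card_upCount_ge_le σ hval ht (by omega) h
          _ = 2 ^ (t - h) * Fintype.card (CycleDatum n) := by
              rw [Finset.sum_const, Finset.card_univ, smul_eq_mul, mul_comm]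
    _ = (2 * par.length + 1) * 2 ^ (t - h) * Fintype.card (CycleDatum n) := by
        rw [Finset.sum_const, Finset.card_range, smul_eq_mul]; ring

end GluedTrees

end Literature.Computability.QuantumComplexity

/-!
# Glued trees, Theorem 9 (classical lower bound) — XII: the part of the embedding inside the ENTRANCE tree, side branches

Theorem-only support file for `ChildsEtAl2003_thm9` (geometry of the random embedding,
Lemma 8 of the source, p. 13). Facts that hold for EVERY cycle datum and coin vector:

* `tdepth_pos`, `parentOf_eq_of_valid`: the abstract tree of a valid expansion list;
* `aPos_succ`: the coin-only position unfolded;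
* **`regionA`**: a node of tree depth `≤ n` sits at its coin-only position `aPos`, at depth equal
  to its tree depth, in the ENTRANCE tree, reached by a down-move from its parent node — the
  image of `T` before any crossing is a top-down copy determined by the coins alone;
* `isCross_of_tdepth_eq`: a node of tree depth `n + 1` is reached by a cross move;
* `land_*`: unfolding the landing node;
* `sib_*`, `isDesc_*`: side branches above a leaf and the subtree relation (distinct side
  branches are disjoint, contain no ancestor of the leaf, are preserved by going down).

## References

* [ChildsEtAl2003] A. M. Childs et al., Exponential algorithmic speedup by a quantum walk,
  STOC 2003, §4, Lemma 8.
-/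

open Literature.Computability.Complexity

namespace Literature.Computability.QuantumComplexity

namespace GluedTrees

open Finset

variable {n : ℕ}

/-! ### The abstract tree -/

/-- The tree depth of a non-root node of a valid list is one more than its parent's.
[cite: ChildsEtAl2003, §4 (Game 5)] -/
theorem tdepth_eq_of_valid {par : List ℕ} (hval : ∀ i (h : i < par.length), par[i] ≤ 2 * i)
    {m : ℕ} (hm1 : 1 ≤ m) (hm : m ≤ 2 * par.length) :
    tdepth par m = tdepth par (parentOf par m) + 1 := by
  obtain ⟨-, hlt⟩ := parentOf_lt hval hm1 hm
  obtain ⟨k, rfl⟩ : ∃ k, m = k + 1 := ⟨m - 1, by omega⟩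
  rw [tdepth, if_pos (by omega)]

/-- `tdepth 0 = 0`. [folklore] -/
@[simp] theorem tdepth_zero (par : List ℕ) : tdepth par 0 = 0 := by rw [tdepth]

/-- The coin-only position of a non-root node of a valid list: the child of the parent's
coin-only position numbered by the coin (node `2j+1`) or its negation (node `2j+2`).
[cite: ChildsEtAl2003, §4 (Game 5)] -/
theorem aPos_eq_of_valid {par : List ℕ} (hval : ∀ i (h : i < par.length), par[i] ≤ 2 * i)
    (c : ℕ → Bool) {m : ℕ} (hm1 : 1 ≤ m) (hm : m ≤ 2 * par.length) :
    aPos (n := n) par c m = childV (aPos par c (parentOf par m))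
      (if m % 2 = 1 then c ((m - 1) / 2) else !c ((m - 1) / 2)) := by
  obtain ⟨-, hlt⟩ := parentOf_lt hval hm1 hm
  obtain ⟨k, rfl⟩ : ∃ k, m = k + 1 := ⟨m - 1, by omega⟩
  rw [aPos, if_pos (by omega)]
  simp only [Nat.add_sub_cancel]
  congr 1
  rcases Nat.mod_two_eq_zero_or_one k with h | h
  · rw [if_pos h, if_pos (by omega)]
  · rw [if_neg (by omega), if_neg (by omega)]

/-- The parent lookup of the two children of expansion `j`. [folklore] -/
theorem parentOf_child {par : List ℕ} {j : ℕ} (hj : j < par.length) :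
    parentOf par (2 * j + 1) = par[j] ∧ parentOf par (2 * j + 2) = par[j] := by
  unfold parentOf
  rw [List.getD_eq_getElem?_getD, List.getD_eq_getElem?_getD, show (2 * j + 1 - 1) / 2 = j by omega,
    show (2 * j + 2 - 1) / 2 = j by omega, List.getElem?_eq_getElem hj]
  exact ⟨rfl, rfl⟩

/-- Every non-root node is `2j+1` or `2j+2` for its creating expansion `j = (m-1)/2`. [folklore] -/
theorem node_eq_child (m : ℕ) (hm : 1 ≤ m) : m = 2 * ((m - 1) / 2) + 1 ∨ m = 2 * ((m - 1) / 2) + 2 := by omega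

/-! ### Region A: the coin-only part of the embedding -/

/-- **The embedding inside the ENTRANCE tree is the coin-only tree.** For a valid list, `1 ≤ n`
and any `σ`, `c`: a node of tree depth `≤ n` sits at its coin-only position, at depth equal to
its tree depth, on the ENTRANCE side, and (unless it is the root) was reached by a DOWN move
from a parent position of depth `< n`. [cite: ChildsEtAl2003, §4 (Lemma 8: the image of `T` in the left tree)] -/
theorem regionA (σ : CycleDatum n) {par : List ℕ} (hval : ∀ i (h : i < par.length), par[i] ≤ 2 * i)
    (c : ℕ → Bool) :
    ∀ m ≤ 2 * par.length, tdepth par m ≤ n →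
      pos σ par c m = aPos par c m ∧ depth (pos σ par c m) = tdepth par m ∧ (pos σ par c m).1 = false ∧
      (m ≠ 0 → depth (pos σ par c (parentOf par m)) < n ∧
        pos σ par c m = childV (pos σ par c (parentOf par m)) (if m % 2 = 1 then c ((m - 1) / 2) else !c ((m - 1) / 2))) := by
  intro m
  induction m using Nat.strong_induction_on with
  | _ m ih =>
    intro hm htd
    rcases Nat.eq_zero_or_pos m with rfl | hm1
    · rw [pos_zero, aPos]
      exact ⟨rfl, by simp, rfl, fun h ↦ absurd rfl h⟩
    · -- the parent node `q` and the creating expansion `j`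
      set q := parentOf par m with hq
      obtain ⟨hqeq, hqlt⟩ := parentOf_lt hval hm1 hm
      have hqm : q < m := by omega
      have htdq : tdepth par q + 1 = tdepth par m := (tdepth_eq_of_valid hval hm1 hm).symm
      obtain ⟨ihpos, ihdepth, ihside, ihmove⟩ := ih q hqm (by omega) (by omega)
      have hdq : depth (pos σ par c q) < n := by rw [ihdepth]; omega
      set j := (m - 1) / 2 with hj
      have hjlt : j < par.length := by omega
      have hpj : par[j] = q := by rw [hq, hqeq]
      obtain ⟨c1, c2⟩ := pos_child_eq σ hval c hjlt
      rw [hpj] at c1 c2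
      -- the entering vertex of `q` is its parent vertex (or none at the root)
      have hopts : stepOpts σ (pos σ par c q) (if q = 0 then none else some (pos σ par c (parentOf par q))) =
          [childV (pos σ par c q) false, childV (pos σ par c q) true] := by
        by_cases hq0 : q = 0
        · rw [if_pos hq0]; exact stepOpts_none hdq
        · rw [if_neg hq0]
          obtain ⟨hdqq, hmv⟩ := ihmove hq0
          have : pos σ par c (parentOf par q) = parentV (pos σ par c q) := by
            rw [hmv, parentV_childV hdqq]
          rw [this]
          exact stepOpts_parentV_of_depth_lt hdq
      rw [hopts] at c1 c2
      have hmove : pos σ par c m = childV (pos σ par c q) (if m % 2 = 1 then c ((m - 1) / 2) else !c ((m - 1) / 2)) := by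
        rcases node_eq_child m hm1 with hmo | hme
        · rw [← hj] at hmo
          have h1 : (2 * j + 1) % 2 = 1 := by omega
          have h2 : (2 * j + 1 - 1) / 2 = j := by omega
          rw [hmo, c1, if_pos h1, h2]
          cases c j <;> rfl
        · rw [← hj] at hme
          have h1 : ¬ (2 * j + 2) % 2 = 1 := by omega
          have h2 : (2 * j + 2 - 1) / 2 = j := by omega
          rw [hme, c2, if_neg h1, h2]
          cases c j <;> rfl
      refine ⟨?_, ?_, ?_, fun _ ↦ ⟨hdq, hmove⟩⟩
      · rw [hmove, aPos_eq_of_valid hval c hm1 hm, ← hq, ihpos]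
      · rw [hmove, depth_childV hdq, ihdepth, htdq]
      · rw [hmove, childV_fst, ihside]

/-- **The first move out of the ENTRANCE tree is a cross move**: a node of tree depth `n + 1`
sits at a cross neighbour of the leaf holding its parent node. [cite: ChildsEtAl2003, §4 (Lemma 8)] -/
theorem isCross_of_tdepth_eq (hn : 1 ≤ n) (σ : CycleDatum n) {par : List ℕ} (hval : ∀ i (h : i < par.length), par[i] ≤ 2 * i)
    (c : ℕ → Bool) {m : ℕ} (hm : m ≤ 2 * par.length) (htd : tdepth par m = n + 1) :
    IsCross σ par c m ∧ (pos σ par c m = cross₁ σ (pos σ par c (parentOf par m)) ∨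
      pos σ par c m = cross₂ σ (pos σ par c (parentOf par m))) := by
  have hm1 : 1 ≤ m := by
    rcases Nat.eq_zero_or_pos m with rfl | h
    · simp at htd
    · exact h
  set q := parentOf par m with hq
  obtain ⟨hqeq, hqlt⟩ := parentOf_lt hval hm1 hm
  have htdq : tdepth par q = n := by have := tdepth_eq_of_valid hval hm1 hm; rw [← hq] at this; omega
  obtain ⟨-, hdepth, -, hmove⟩ := regionA σ hval c q (by omega) htdq.le
  have hdq : depth (pos σ par c q) = n := by rw [hdepth, htdq]
  set j := (m - 1) / 2 with hj
  have hjlt : j < par.length := by omega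
  have hpj : par[j] = q := by rw [hq, hqeq]
  obtain ⟨c1, c2⟩ := pos_child_eq σ hval c hjlt
  rw [hpj] at c1 c2
  have hopts : stepOpts σ (pos σ par c q) (if q = 0 then none else some (pos σ par c (parentOf par q))) =
      [cross₁ σ (pos σ par c q), cross₂ σ (pos σ par c q)] := by
    have hq0 : q ≠ 0 := by
      intro h0; rw [h0, pos_zero] at hdq; simp at hdq; omega
    rw [if_neg hq0]
    obtain ⟨hdqq, hmv⟩ := hmove hq0
    have : pos σ par c (parentOf par q) = parentV (pos σ par c q) := by rw [hmv, parentV_childV hdqq]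
    rw [this]
    exact stepOpts_parentV_of_depth_eq hdq
  rw [hopts] at c1 c2
  have hpos : pos σ par c m = cross₁ σ (pos σ par c q) ∨ pos σ par c m = cross₂ σ (pos σ par c q) := by
    rcases node_eq_child m hm1 with hmo | hme
    · rw [← hj] at hmo; rw [hmo, c1]; cases c j <;> simp
    · rw [← hj] at hme; rw [hme, c2]; cases c j <;> simp
  refine ⟨⟨by omega, hdq, ?_⟩, hpos⟩
  rcases hpos with h | h
  · rw [h, depth_cross₁ hdq]
  · rw [h, depth_cross₂ hdq]

/-- Nodes of tree depth `> n` are exactly those beyond the ENTRANCE tree; the tree depth of a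
child. [folklore] -/
theorem tdepth_child {par : List ℕ} (hval : ∀ i (h : i < par.length), par[i] ≤ 2 * i) {j : ℕ} (hj : j < par.length) :
    tdepth par (2 * j + 1) = tdepth par par[j] + 1 ∧ tdepth par (2 * j + 2) = tdepth par par[j] + 1 := by
  obtain ⟨h1, h2⟩ := parentOf_child (par := par) hj
  constructor
  · rw [tdepth_eq_of_valid hval (by omega) (by omega), h1]
  · rw [tdepth_eq_of_valid hval (by omega) (by omega), h2]

/-! ### The landing node -/

/-- `land 0 = 0`. [folklore] -/
@[simp] theorem land_zero (σ : CycleDatum n) (par : List ℕ) (c : ℕ → Bool) : land σ par c 0 = 0 := by rw [land]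

/-- A cross node is its own landing node. [cite: ChildsEtAl2003, §4 (Lemma 8 (ii))] -/
theorem land_of_isCross (σ : CycleDatum n) (par : List ℕ) (c : ℕ → Bool) {m : ℕ} (h : IsCross σ par c m) :
    land σ par c m = m := by
  obtain ⟨k, rfl⟩ : ∃ k, m = k + 1 := ⟨m - 1, by have := h.1; omega⟩
  rw [land, if_pos h]

/-- The landing node of a non-cross non-root node is its parent's. [cite: ChildsEtAl2003, §4 (Lemma 8 (ii))] -/
theorem land_of_not_isCross (σ : CycleDatum n) (par : List ℕ) (c : ℕ → Bool) {m : ℕ} (hm : m ≠ 0)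
    (h : ¬ IsCross σ par c m) (hp : parentOf par m < m) : land σ par c m = land σ par c (parentOf par m) := by
  obtain ⟨k, rfl⟩ : ∃ k, m = k + 1 := ⟨m - 1, by omega⟩
  rw [land, if_neg h, if_pos hp]

/-! ### Side branches and subtrees -/

/-- A vertex is in its own subtree. [folklore] -/
theorem isDesc_refl (w : Vertex n) : IsDesc w w := ⟨le_rfl, by simp⟩

/-- Subtrees are closed under going down. [folklore] -/
theorem isDesc_childV {w z : Vertex n} (h : IsDesc w z) (hz : depth z < n) (b : Bool) : IsDesc w (childV z b) := by
  obtain ⟨h1, h2⟩ := h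
  refine ⟨by rw [depth_childV hz]; omega, ?_⟩
  rw [depth_childV hz, show depth z + 1 - depth w = (depth z - depth w) + 1 by omega, anc_childV hz, h2]

/-- A member of a subtree is at least as deep as the root, and the root is its ancestor. [folklore] -/
theorem anc_eq_of_isDesc {w z : Vertex n} (h : IsDesc w z) : anc z (depth z - depth w) = w := h.2

/-- An ancestor of a vertex in the subtree of `w`, no higher than `w`, is in the subtree. [folklore] -/
theorem isDesc_anc {w z : Vertex n} (h : IsDesc w z) {u : ℕ} (hu : u ≤ depth z - depth w) : IsDesc w (anc z u) := by
  obtain ⟨h1, h2⟩ := h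
  refine ⟨by rw [depth_anc]; omega, ?_⟩
  rw [depth_anc, anc_anc, show u + (depth z - u - depth w) = depth z - depth w by omega, h2]

/-- The side branch root: a child of `anc ℓ r` other than `anc ℓ (r-1)` (`1 ≤ r ≤ depth ℓ`).
[cite: ChildsEtAl2003, §4 (Lemma 8)] -/
theorem sib_spec {ℓ : Vertex n} {r : ℕ} (hr1 : 1 ≤ r) (hr : r ≤ depth ℓ) (hℓ : depth ℓ ≤ n) :
    parentV (sib ℓ r) = anc ℓ r ∧ depth (sib ℓ r) = depth ℓ + 1 - r ∧ sib ℓ r ≠ anc ℓ (r - 1) ∧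
      (sib ℓ r = childV (anc ℓ r) false ∨ sib ℓ r = childV (anc ℓ r) true) := by
  have hd : depth (anc ℓ r) < n := by rw [depth_anc]; omega
  have hchild : anc ℓ (r - 1) = childV (anc ℓ r) false ∨ anc ℓ (r - 1) = childV (anc ℓ r) true := by
    have : IsChild (anc ℓ (r - 1)) (anc ℓ r) := by
      rw [isChild_iff_eq_parentV]
      refine ⟨by rw [depth_anc]; omega, ?_⟩
      rw [← anc_succ, show r - 1 + 1 = r by omega]
    exact (isChild_iff_eq_childV.mp this).2
  unfold sib otherChild
  rcases hchild with h0 | h1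
  · rw [if_pos h0]
    refine ⟨parentV_childV hd _, by rw [depth_childV hd, depth_anc]; omega, ?_, Or.inr rfl⟩
    rw [h0]; exact (childV_false_ne_true hd).symm
  · have hne : anc ℓ (r - 1) ≠ childV (anc ℓ r) false := by rw [h1]; exact (childV_false_ne_true hd).symm
    rw [if_neg hne]
    refine ⟨parentV_childV hd _, by rw [depth_childV hd, depth_anc]; omega, ?_, Or.inl rfl⟩
    rw [h1]; exact childV_false_ne_true hd

/-- A side branch contains no ancestor of the leaf (nor the leaf). [cite: ChildsEtAl2003, §4 (Lemma 8)] -/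
theorem not_isDesc_sib_anc {ℓ : Vertex n} {r : ℕ} (hr1 : 1 ≤ r) (hr : r ≤ depth ℓ) (hℓ : depth ℓ ≤ n) (u : ℕ) :
    ¬ IsDesc (sib ℓ r) (anc ℓ u) := by
  intro ⟨h1, h2⟩
  obtain ⟨-, hds, hne, -⟩ := sib_spec hr1 hr hℓ
  rw [depth_anc] at h1 h2
  rw [anc_anc] at h2
  apply hne
  rw [← h2, hds]
  congr 1
  omega

/-- Distinct side branches are disjoint. [cite: ChildsEtAl2003, §4 (Lemma 8)] -/
theorem sib_branch_disjoint {ℓ : Vertex n} {r r' : ℕ} (hr1 : 1 ≤ r) (hr'1 : 1 ≤ r') (hr : r ≤ depth ℓ) (hr' : r' ≤ depth ℓ)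
    (hℓ : depth ℓ ≤ n) {z : Vertex n} (hz : IsDesc (sib ℓ r) z) (hz' : IsDesc (sib ℓ r') z) : r = r' := by
  by_contra hne
  -- w.l.o.g. `r < r'`: then `sib ℓ r'` is an ancestor of `sib ℓ r`, i.e. of `anc ℓ r`
  wlog hlt : r < r' generalizing r r'
  · exact this hr'1 hr1 hr' hr hz' hz (Ne.symm hne) (by omega)
  obtain ⟨hp, hds, -, -⟩ := sib_spec hr1 hr hℓ
  obtain ⟨-, hds', hne', -⟩ := sib_spec hr'1 hr' hℓ
  obtain ⟨h1, h2⟩ := hz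
  obtain ⟨h1', h2'⟩ := hz'
  rw [hds] at h1 h2
  rw [hds'] at h1' h2'
  -- the ancestor of `z` at the depth of `sib ℓ r'` factors through `sib ℓ r`
  have key : anc (sib ℓ r) (r' - r) = sib ℓ r' := by
    rw [← h2, anc_anc, show depth z - (depth ℓ + 1 - r) + (r' - r) = depth z - (depth ℓ + 1 - r') by omega]
    exact h2'
  have hstep : anc (sib ℓ r) (r' - r) = anc ℓ (r' - 1) := by
    rw [show r' - r = (r' - r - 1) + 1 by omega, anc_succ', hp, anc_anc]
    congr 1; omega
  exact hne' (key.symm.trans hstep)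
where
  /-- `anc v (u+1) = anc (parentV v) u`. [folklore] -/
  anc_succ' : ∀ (v : Vertex n) (u : ℕ), anc v (u + 1) = anc (parentV v) u := fun v u ↦ (anc_parentV v u).symm

end GluedTrees

end Literature.Computability.QuantumComplexity

/-!
# Glued trees, Theorem 9 (classical lower bound) — X: the embedding reads the cycle only through the read slots

Theorem-only support file for `ChildsEtAl2003_thm9` (the "deferred decisions" behind part (ii)
of Lemma 8, p. 13: "by the construction of the random cycle"). The random embedding of a fixed
tree with fixed coins depends on the cycle datum `σ` only through the leaves sitting in the
slots it has READ (`revSlots`):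

* `stepOpts_congr_of_depth_lt`, `cross_congr`: the onward options at an inner vertex do not
  depend on `σ`; at a leaf they depend only on the leaves in the two neighbouring slots;
* `pos_revSlots_congr`: two cycle data agreeing (slot by slot) on the slots read by the first
  `j` expansions give the same first `2j+1` positions and the same read sets;
* `slotVal_swapPos_*`, `slotVal_swapVal_*`: re-randomising an UNREAD position (pre-composing
  `e` or `f` with a transposition of positions) or an UNREAD value (post-composing with a
  transposition of leaf indices) does not change the leaves in the read slots — the symmetries
  used by the counting in `GluedTreesThm9EmbProb`.

## References

* [ChildsEtAl2003] A. M. Childs et al., Exponential algorithmic speedup by a quantum walk,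
  STOC 2003, §2 and §4, Lemma 8 (ii).
-/

open Literature.Computability.Complexity

namespace Literature.Computability.QuantumComplexity

namespace GluedTrees

open Finset

variable {n : ℕ}

/-! ### What the onward options read -/

/-- At an inner vertex the onward options do not depend on the cycle. [cite: ChildsEtAl2003, §4 (Game 5)] -/
theorem stepOpts_congr_of_depth_lt (σ σ' : CycleDatum n) {v : Vertex n} (hv : depth v < n) (u : Option (Vertex n)) :
    stepOpts σ' v u = stepOpts σ v u := by
  unfold stepOpts; rw [if_pos hv, if_pos hv]

/-- At a leaf the onward options depend only on the two cross neighbours. [cite: ChildsEtAl2003, §4 (Game 5)] -/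
theorem stepOpts_congr_of_cross_eq (σ σ' : CycleDatum n) {v : Vertex n}
    (h1 : cross₁ σ' v = cross₁ σ v) (h2 : cross₂ σ' v = cross₂ σ v) (u : Option (Vertex n)) :
    stepOpts σ' v u = stepOpts σ v u := by
  unfold stepOpts; rw [h1, h2]

/-- **The cross neighbours are read off the neighbouring slots**: if `σ'` has the leaf `v` in
the same slot as `σ` and the same leaves in the two neighbouring slots, then `v` has the same
cross neighbours (`1 ≤ n`). [cite: ChildsEtAl2003, §4 (Lemma 8 (ii))] -/
theorem cross_congr (hn : 1 ≤ n) (σ σ' : CycleDatum n) {v : Vertex n} (hv : depth v = n)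
    (h0 : slotVal σ' (slotOf σ v) = v)
    (h1 : slotVal σ' (slotOf σ v + 1) = slotVal σ (slotOf σ v + 1))
    (h2 : slotVal σ' (slotOf σ v - 1) = slotVal σ (slotOf σ v - 1)) :
    cross₁ σ' v = cross₁ σ v ∧ cross₂ σ' v = cross₂ σ v := by
  have hx : slotOf σ' v = slotOf σ v := by
    have := congrArg (slotOf σ') h0
    rw [slotOf_slotVal] at this
    exact this.symm
  obtain ⟨i, rfl | rfl⟩ := exists_eq_leaf hv
  · obtain ⟨a1, a2⟩ := cross_eq_slotVal_left hn σ i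
    obtain ⟨b1, b2⟩ := cross_eq_slotVal_left hn σ' i
    rw [a1, a2, b1, b2, hx, h1, h2]
    exact ⟨rfl, rfl⟩
  · obtain ⟨a1, a2⟩ := cross_eq_slotVal_right σ i
    obtain ⟨b1, b2⟩ := cross_eq_slotVal_right σ' i
    rw [a1, a2, b1, b2, hx, h1, h2]
    exact ⟨rfl, rfl⟩

/-! ### The read sets -/

/-- `revSlots … 0 = ∅`. [folklore] -/
@[simp] theorem revSlots_zero (σ : CycleDatum n) (par : List ℕ) (c : ℕ → Bool) : revSlots σ par c 0 = ∅ := rfl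

/-- One more expansion reads the slot of the expanded node and its two neighbours, if it sits at
a leaf. [cite: ChildsEtAl2003, §4 (Lemma 8 (ii))] -/
theorem revSlots_succ (σ : CycleDatum n) (par : List ℕ) (c : ℕ → Bool) (j : ℕ) :
    revSlots σ par c (j + 1) = revSlots σ par c j ∪
      (if depth (pos σ par c (par.getD j 0)) = n then
        {slotOf σ (pos σ par c (par.getD j 0)), slotOf σ (pos σ par c (par.getD j 0)) + 1,
          slotOf σ (pos σ par c (par.getD j 0)) - 1}
      else ∅) := rfl

/-- The read sets grow. [folklore] -/
theorem revSlots_mono (σ : CycleDatum n) (par : List ℕ) (c : ℕ → Bool) {j j' : ℕ} (h : j ≤ j') :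
    revSlots σ par c j ⊆ revSlots σ par c j' := by
  induction j' with
  | zero =>
    obtain rfl : j = 0 := by omega
    exact le_rfl
  | succ j' ih =>
    rcases Nat.lt_or_ge j' j with hlt | hge
    · obtain rfl : j = j' + 1 := by omega
      exact le_rfl
    · exact (ih hge).trans (by rw [revSlots_succ]; exact Finset.subset_union_left)

/-- At most three slots are read per expansion. [cite: ChildsEtAl2003, §4 (Lemma 8 (ii))] -/
theorem card_revSlots_le (σ : CycleDatum n) (par : List ℕ) (c : ℕ → Bool) (j : ℕ) :
    (revSlots σ par c j).card ≤ 3 * j := by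
  induction j with
  | zero => simp
  | succ j ih =>
    rw [revSlots_succ]
    refine (Finset.card_union_le _ _).trans ?_
    have : (if depth (pos σ par c (par.getD j 0)) = n then
        ({slotOf σ (pos σ par c (par.getD j 0)), slotOf σ (pos σ par c (par.getD j 0)) + 1,
          slotOf σ (pos σ par c (par.getD j 0)) - 1} : Finset (Slot n)) else ∅).card ≤ 3 := by
      split_ifs
      · exact Finset.card_le_three
      · simp
    omega

/-- The slots read at an expansion of a node sitting at a leaf. [cite: ChildsEtAl2003, §4 (Lemma 8 (ii))] -/
theorem mem_revSlots_succ_of_depth_eq (σ : CycleDatum n) (par : List ℕ) (c : ℕ → Bool) {j : ℕ}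
    (hv : depth (pos σ par c (par.getD j 0)) = n) :
    slotOf σ (pos σ par c (par.getD j 0)) ∈ revSlots σ par c (j + 1) ∧
      slotOf σ (pos σ par c (par.getD j 0)) + 1 ∈ revSlots σ par c (j + 1) ∧
      slotOf σ (pos σ par c (par.getD j 0)) - 1 ∈ revSlots σ par c (j + 1) := by
  rw [revSlots_succ, if_pos hv]
  refine ⟨?_, ?_, ?_⟩ <;> apply Finset.mem_union_right <;> simp

/-! ### Determinism -/

/-- **The embedding reads `σ` only through the read slots.** For a valid expansion list, if two
cycle data have the same leaves in every slot read by the first `j` expansions (of the first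
datum), then the first `2j+1` nodes have the same positions and the first `j+1` read sets agree.
[cite: ChildsEtAl2003, §4 (Lemma 8 (ii): "by the construction of the random cycle")] -/
theorem pos_revSlots_congr (hn : 1 ≤ n) {par : List ℕ} (hval : ∀ i (h : i < par.length), par[i] ≤ 2 * i)
    (c : ℕ → Bool) (σ σ' : CycleDatum n) :
    ∀ j ≤ par.length, (∀ s ∈ revSlots σ par c j, slotVal σ' s = slotVal σ s) →
      (∀ m ≤ 2 * j, pos σ' par c m = pos σ par c m) ∧ (∀ j' ≤ j, revSlots σ' par c j' = revSlots σ par c j') := by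
  intro j
  induction j with
  | zero =>
    intro _ _
    refine ⟨fun m hm ↦ ?_, fun j' hj' ↦ ?_⟩
    · obtain rfl : m = 0 := by omega
      rw [pos_zero, pos_zero]
    · obtain rfl : j' = 0 := by omega
      rfl
  | succ j ih =>
    intro hj hagree
    have hagree' : ∀ s ∈ revSlots σ par c j, slotVal σ' s = slotVal σ s :=
      fun s hs ↦ hagree s (revSlots_mono σ par c (Nat.le_succ j) hs)
    obtain ⟨ihpos, ihrev⟩ := ih (by omega) hagree'
    have hjlt : j < par.length := hj
    -- the expanded node and its entering vertex are old
    have hpj : par.getD j 0 = par[j] := by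
      rw [List.getD_eq_getElem?_getD, List.getElem?_eq_getElem hjlt]; rfl
    have hp_le : par[j] ≤ 2 * j := hval j hjlt
    set p := par[j] with hp
    have hv : pos σ' par c p = pos σ par c p := ihpos p hp_le
    have hu : (if p = 0 then none else some (pos σ' par c (parentOf par p))) =
        (if p = 0 then none else some (pos σ par c (parentOf par p))) := by
      by_cases hp0 : p = 0
      · simp [hp0]
      · rw [if_neg hp0, if_neg hp0, ihpos]
        unfold parentOf
        rw [List.getD_eq_getElem?_getD, List.getElem?_eq_getElem (show (p - 1) / 2 < par.length by omega)]
        simp only [Option.getD_some]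
        have := hval ((p - 1) / 2) (by omega)
        omega
    -- the onward options agree
    have hopts : stepOpts σ' (pos σ par c p) (if p = 0 then none else some (pos σ par c (parentOf par p))) =
        stepOpts σ (pos σ par c p) (if p = 0 then none else some (pos σ par c (parentOf par p))) := by
      by_cases hleaf : depth (pos σ par c p) = n
      · have hmem := mem_revSlots_succ_of_depth_eq σ par c (j := j) (by rw [hpj]; exact hleaf)
        rw [hpj] at hmem
        obtain ⟨m0, m1, m2⟩ := hmem
        have h0 := hagree _ m0
        rw [slotVal_slotOf σ hleaf] at h0
        obtain ⟨c1, c2⟩ := cross_congr hn σ σ' hleaf h0 (hagree _ m1) (hagree _ m2)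
        exact stepOpts_congr_of_cross_eq σ σ' c1 c2 _
      · exact stepOpts_congr_of_depth_lt σ σ' (lt_of_le_of_ne (depth_le _) hleaf) _
    -- new positions
    obtain ⟨n1, n2⟩ := pos_child_eq σ hval c hjlt
    obtain ⟨n1', n2'⟩ := pos_child_eq σ' hval c hjlt
    rw [← hp] at n1 n2 n1' n2'
    rw [hv, hu, hopts] at n1' n2'
    have hposnew : ∀ m ≤ 2 * (j + 1), pos σ' par c m = pos σ par c m := by
      intro m hm
      rcases (by omega : m ≤ 2 * j ∨ m = 2 * j + 1 ∨ m = 2 * j + 2) with h | rfl | rfl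
      · exact ihpos m h
      · rw [n1, n1']
      · rw [n2, n2']
    refine ⟨hposnew, fun j' hj' ↦ ?_⟩
    rcases Nat.lt_or_ge j' (j + 1) with hlt | hge
    · exact ihrev j' (by omega)
    · obtain rfl : j' = j + 1 := by omega
      rw [revSlots_succ, revSlots_succ, ihrev j le_rfl, hpj, hv]
      by_cases hleaf : depth (pos σ par c p) = n
      · rw [if_pos hleaf, if_pos hleaf]
        have hmem := mem_revSlots_succ_of_depth_eq σ par c (j := j) (by rw [hpj]; exact hleaf)
        rw [hpj] at hmem
        have h0 := hagree _ hmem.1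
        rw [slotVal_slotOf σ hleaf] at h0
        have hx : slotOf σ' (pos σ par c p) = slotOf σ (pos σ par c p) := by
          have := congrArg (slotOf σ') h0
          rw [slotOf_slotVal] at this
          exact this.symm
        rw [hx]
      · rw [if_neg hleaf, if_neg hleaf]

/-! ### Re-randomising an unread position or value -/

/-- Pre-composing `e` with a permutation `τ` of positions: slot `2k` now holds `e (τ k)`.
[cite: ChildsEtAl2003, §4 (Lemma 8 (ii))] -/
theorem slotVal_preL (σ : CycleDatum n) (τ : Equiv.Perm (Fin (2 ^ n))) (s : Slot n) :
    slotVal (τ.trans σ.1, σ.2) s = if s.val % 2 = 0 then leafL n (σ.1 (τ (slotPos s))) else slotVal σ s := by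
  unfold slotVal
  split_ifs with h <;> rfl

/-- Pre-composing `f` with a permutation `τ` of positions: slot `2k+1` now holds `f (τ k)`.
[cite: ChildsEtAl2003, §4 (Lemma 8 (ii))] -/
theorem slotVal_preR (σ : CycleDatum n) (τ : Equiv.Perm (Fin (2 ^ n))) (s : Slot n) :
    slotVal (σ.1, τ.trans σ.2) s = if s.val % 2 = 0 then slotVal σ s else leafR n (σ.2 (τ (slotPos s))) := by
  unfold slotVal
  split_ifs with h <;> rfl

/-- Post-composing `e` with a permutation `ρ` of leaf indices: slot `2k` now holds `ρ (e k)`.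
[cite: ChildsEtAl2003, §4 (Lemma 8 (ii))] -/
theorem slotVal_postL (σ : CycleDatum n) (ρ : Equiv.Perm (Fin (2 ^ n))) (s : Slot n) :
    slotVal (σ.1.trans ρ, σ.2) s = if s.val % 2 = 0 then leafL n (ρ (σ.1 (slotPos s))) else slotVal σ s := by
  unfold slotVal
  split_ifs with h <;> rfl

/-- Post-composing `f` with a permutation `ρ` of leaf indices: slot `2k+1` now holds `ρ (f k)`.
[cite: ChildsEtAl2003, §4 (Lemma 8 (ii))] -/
theorem slotVal_postR (σ : CycleDatum n) (ρ : Equiv.Perm (Fin (2 ^ n))) (s : Slot n) :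
    slotVal (σ.1, σ.2.trans ρ) s = if s.val % 2 = 0 then slotVal σ s else leafR n (ρ (σ.2 (slotPos s))) := by
  unfold slotVal
  split_ifs with h <;> rfl

/-- A slot is even or odd: `s = 2 · slotPos s + (s mod 2)`. [folklore] -/
theorem slot_eq_two_mul_slotPos_add (s : Slot n) : s = ((2 * (slotPos s : ℕ) + s.val % 2 : ℕ) : Slot n) := by
  conv_lhs => rw [slot_eq_natCast_val s]
  congr 1
  show s.val = 2 * (s.val / 2) + s.val % 2
  omega

/-- **Re-randomising unread positions is invisible.** If the transposition of positions `τ`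
fixes the position of every even read slot, pre-composing `e` with it does not change the
leaves in the read slots. [cite: ChildsEtAl2003, §4 (Lemma 8 (ii))] -/
theorem slotVal_preL_eq_of_fix (σ : CycleDatum n) (τ : Equiv.Perm (Fin (2 ^ n))) (R : Finset (Slot n))
    (hτ : ∀ s ∈ R, s.val % 2 = 0 → τ (slotPos s) = slotPos s) :
    ∀ s ∈ R, slotVal (τ.trans σ.1, σ.2) s = slotVal σ s := by
  intro s hs
  rw [slotVal_preL]
  split_ifs with h
  · rw [hτ s hs h]; unfold slotVal; rw [if_pos h]
  · rfl

/-- Same for `f` and the odd read slots. [cite: ChildsEtAl2003, §4 (Lemma 8 (ii))] -/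
theorem slotVal_preR_eq_of_fix (σ : CycleDatum n) (τ : Equiv.Perm (Fin (2 ^ n))) (R : Finset (Slot n))
    (hτ : ∀ s ∈ R, s.val % 2 ≠ 0 → τ (slotPos s) = slotPos s) :
    ∀ s ∈ R, slotVal (σ.1, τ.trans σ.2) s = slotVal σ s := by
  intro s hs
  rw [slotVal_preR]
  split_ifs with h
  · rfl
  · rw [hτ s hs h]; unfold slotVal; rw [if_neg h]

/-- **Re-randomising unread values is invisible.** If the permutation of leaf indices `ρ` fixes
the index of the leaf in every even read slot, post-composing `e` with it does not change the
leaves in the read slots. [cite: ChildsEtAl2003, §4 (Lemma 8 (ii))] -/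
theorem slotVal_postL_eq_of_fix (σ : CycleDatum n) (ρ : Equiv.Perm (Fin (2 ^ n))) (R : Finset (Slot n))
    (hρ : ∀ s ∈ R, s.val % 2 = 0 → ρ (σ.1 (slotPos s)) = σ.1 (slotPos s)) :
    ∀ s ∈ R, slotVal (σ.1.trans ρ, σ.2) s = slotVal σ s := by
  intro s hs
  rw [slotVal_postL]
  split_ifs with h
  · rw [hρ s hs h]; unfold slotVal; rw [if_pos h]
  · rfl

/-- Same for `f` and the odd read slots. [cite: ChildsEtAl2003, §4 (Lemma 8 (ii))] -/
theorem slotVal_postR_eq_of_fix (σ : CycleDatum n) (ρ : Equiv.Perm (Fin (2 ^ n))) (R : Finset (Slot n))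
    (hρ : ∀ s ∈ R, s.val % 2 ≠ 0 → ρ (σ.2 (slotPos s)) = σ.2 (slotPos s)) :
    ∀ s ∈ R, slotVal (σ.1, σ.2.trans ρ) s = slotVal σ s := by
  intro s hs
  rw [slotVal_postR]
  split_ifs with h
  · rfl
  · rw [hρ s hs h]; unfold slotVal; rw [if_neg h]

end GluedTrees

end Literature.Computability.QuantumComplexity
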